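import Mathlib
import HarnessLib
import Summits.HubbardSuperconductivity.HubbardSuperconductivity.Theorems.KLProgrammeC4aPPKernelMidCalculus

/-!
# Route `KLProgramme` — crux C4a, S3 brick (B4) «(B4)-UMK1», «(U1)-M-LAW» kernel side: the ROWS of the smooth comparable-levels piece `M` —
# envelopes `|M| ≤ C₀/max`, `|∂ᵤM| ≤ C₁/max²`, `|∂ᵤ²M| ≤ C₂/max³` at every loop level `e > 0` and every partner level, comparability support both ways, joint continuity

Cell `gate-hubbard-kl`, seat hubbard-kl-k3c3-p1 (g17; row «δμ-flow with klAngularMean constant piece»).  Part 2 of the M-rows for k3c3-p3's «(U1)-M-LAW» (pen (R384)(A)(a);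
consumer: 5b-M `…C4aPreCausticLevelLineMiddle.abs_intervalIntegral_levelLine_middle_le`, binders `hK` (part 1: `contDiff_two_ppMidKernelS_u`), `hK1`, `hK2`, `hcomp`;
the law is linear in the kernel, so after dividing `M` by `max(C₁,C₂)` its normalised rows hold verbatim).  With `q′ := (2−t₁)/t₁` (`≥ 4`), `M := max e |u|`:
* §1 the true kernel on the comparable zone: **`abs_ppTrueKernelDu_le_of_comparable`** (`|∂ᵤP| ≤ C_P1·M⁻²`), **`abs_ppTrueKernelDuu_le_of_comparable`** (`|∂ᵤ²P| ≤ C_P2·M⁻³`)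
  — two regimes: near-shell loop level `e ≤ 2q′lo ≤ 2q′Λ` (all-`u` forms of `…TrueKernelD2`), else the zone forces `e/(2q′) ≤ |u|` (support forms, `c = 1/(2q′)`);
  `C_P1 = 128B₂+216B₁+294+(48B₁+28)q′`, `C_P2 = 512B₃+1664B₂+5280B₁+3424+(256B₂+384B₁+504)q′²+(192B₁+112)q′`;
* §2 THE ROWS (every `0 < e`, every `u ∈ ℝ`; `lo ≤ Λ`): **`abs_ppMidKernelS_le_inv_max'`** (`hK0`: `(1+2κ₀)(12B₁+9)·M⁻¹`), **`abs_deriv_ppMidKernelS_le`**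
  (`hK1`: `((1+2κ₀)C_P1 + 2κ₁(12B₁+9))·M⁻²`), **`abs_iteratedDeriv_two_ppMidKernelS_le`** (`hK2`: `((1+2κ₀)C_P2 + 4κ₁C_P1 + (12B₁+9)(2κ₂+2κ₁(q′+2)))·M⁻³`),
  **`deriv_ppMidKernelS_eq_zero_of_ge`** / `iteratedDeriv_two_…` (`hcomp`: `lo ≤ e`, `2q′e ≤ |u|` ⟹ `0`), **`deriv_ppMidKernelS_eq_zero_of_le`** (mirror: `2q′lo ≤ e`,
  `2q′|u| ≤ e` ⟹ `0`), **`continuous_deriv_ppMidKernelS₂`** (`hKc`: joint continuity of `∂ᵤM` on ℝ²).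
Constants are `T`-, `Λ`-, `lo`- and `n`-free given `B₁,B₂,B₃` (`sup|χ′|,|χ″|,|χ‴|` of the Salmhofer cutoff) and `κ₀,κ₁,κ₂,t₁`.  Not here: the opposite-sign thermal row
`hKopp` and the band flatness `hflatB` (parts 3–4).  Pure real analysis; nothing asserts (C), K3, the window or superconductivity.
References: BGM 2006 §2.4 (2.36) [cite: BenfattoGiulianiMastropietro2006]; FST II CPAM 51 (1998) §3 [cite: FeldmanSalmhoferTrubowitz1998].
-/

noncomputable section

namespace Summit.HubbardSuperconductivity.HubbardSuperconductivity.Theorems.C4a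

set_option linter.dupNamespace false -- summit = problem name (single-conjunct summit), D-0017

open Real Filter Set
open scoped Topology
open Literature.MathematicalPhysics.QuantumLattice Literature.Analysis.SpecialFunctions

section Rows

variable {β Λ : ℝ} (hβ : 0 < β) (hΛ : 0 < Λ) {B₁ B₂ B₃ : ℝ} (hB₁ : ∀ x, |deriv salmhoferCutoff x| ≤ B₁) (hB₂ : ∀ x, |deriv (deriv salmhoferCutoff) x| ≤ B₂)
  (hB₃ : ∀ x, |deriv (deriv (deriv salmhoferCutoff)) x| ≤ B₃)
  {κ κ' κ'' : ℝ → ℝ} (hκ : ∀ t, HasDerivAt κ (κ' t) t) (hκ' : ∀ t, HasDerivAt κ' (κ'' t) t) (hκ''c : Continuous κ'')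
  {κ₀ κ₁ κ₂ : ℝ} (hκb : ∀ t ∈ Icc 0 1, |κ t| ≤ κ₀) (hκ'b : ∀ t ∈ Icc 0 1, |κ' t| ≤ κ₁) (hκ''b : ∀ t ∈ Icc 0 1, |κ'' t| ≤ κ₂)
  {t₁ : ℝ} (ht₀ : 0 < t₁) (ht25 : t₁ ≤ 2 / 5)
  (hκs : ∀ t, t₁ ≤ t → κ t = 0) (hκ's : ∀ t, t₁ ≤ t → κ' t = 0) (hκ''s : ∀ t, t₁ ≤ t → κ'' t = 0)
  (hκ1 : ∀ t, t ≤ t₁ / 2 → κ t = 1) (hκ'1 : ∀ t, t ≤ t₁ / 2 → κ' t = 0) (hκ''1 : ∀ t, t ≤ t₁ / 2 → κ'' t = 0)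
  {lo : ℝ} (hlo : 0 < lo) (hloΛ : lo ≤ Λ)

/-! ## §1 The true kernel's partner derivatives on the comparable zone -/

include ht₀ ht25 in
/-- `q′ = (2−t₁)/t₁ ≥ 4`. [folklore] -/
theorem midRatio_ge_four : 4 ≤ (2 - t₁) / t₁ := by rw [le_div_iff₀ ht₀]; linarith

include hβ hΛ hB₁ hB₂ ht₀ ht25 hlo hloΛ in
/-- **`|∂ᵤP(e,u)| ≤ C_P1·(max e |u|)⁻¹²` on the comparable zone** (`0 < e`, `m̃ₑ < q′m̃ᵤ`): near-shell loop levels by the all-`u` form, the others by the zone's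
support consequence `e/(2q′) ≤ |u|`. [cite: BenfattoGiulianiMastropietro2006, §2.4 (2.36)] -/
theorem abs_ppTrueKernelDu_le_of_comparable {e u : ℝ} (he : 0 < e) (hc : ppSmoothScale lo e < (2 - t₁) / t₁ * ppSmoothScale lo u) :
    |ppTrueKernelDu β Λ e u| ≤ (128 * B₂ + 216 * B₁ + 294 + (48 * B₁ + 28) * ((2 - t₁) / t₁)) * (max e |u|)⁻¹ ^ 2 := by
  have hB0 := salmhoferB₁_nonneg hB₁
  have hB20 : 0 ≤ B₂ := (abs_nonneg _).trans (hB₂ 0)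
  set q : ℝ := (2 - t₁) / t₁ with hq
  have hq4 : 4 ≤ q := midRatio_ge_four ht₀ ht25
  have hI : 0 ≤ (max e |u|)⁻¹ ^ 2 := by positivity
  rcases le_or_gt e (2 * q * lo) with hsmall | hbig
  · -- near-shell loop level: `e ≤ 2q·Λ`
    have hK : e ≤ 2 * q * Λ := hsmall.trans (by nlinarith)
    refine (abs_ppTrueKernelDu_le_inv_max_sq_of_le_mul hβ hΛ hB₁ hB₂ (K := 2 * q) (by linarith) he hK u).trans ?_
    apply mul_le_mul_of_nonneg_right _ hI
    nlinarith
  · have hsupp := comparable_abs_lower ht₀ ht25 hlo hbig.le hc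
    have hc0 : 0 < 1 / (2 * q) := by positivity
    have hc1 : 1 / (2 * q) ≤ 1 := by rw [div_le_one (by positivity)]; linarith
    refine (abs_ppTrueKernelDu_le_inv_max_sq hβ hΛ hB₁ hB₂ hc0 hc1 he hsupp).trans ?_
    apply mul_le_mul_of_nonneg_right _ hI
    have e1 : (12 * B₁ + 9) / (1 / (2 * q)) = (24 * B₁ + 18) * q := by field_simp; ring
    rw [e1]; nlinarith

include hβ hΛ hB₁ hB₂ hB₃ ht₀ ht25 hlo hloΛ in
/-- **`|∂ᵤ²P(e,u)| ≤ C_P2·(max e |u|)⁻¹³ on the comparable zone.** [cite: BenfattoGiulianiMastropietro2006, §2.4 (2.36)] -/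
theorem abs_ppTrueKernelDuu_le_of_comparable {e u : ℝ} (he : 0 < e) (hc : ppSmoothScale lo e < (2 - t₁) / t₁ * ppSmoothScale lo u) :
    |ppTrueKernelDuu β Λ e u| ≤
      (512 * B₃ + 1664 * B₂ + 5280 * B₁ + 3424 + (256 * B₂ + 384 * B₁ + 504) * ((2 - t₁) / t₁) ^ 2 + (192 * B₁ + 112) * ((2 - t₁) / t₁)) * (max e |u|)⁻¹ ^ 3 := by
  have hB0 := salmhoferB₁_nonneg hB₁
  have hB20 : 0 ≤ B₂ := (abs_nonneg _).trans (hB₂ 0)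
  have hB30 : 0 ≤ B₃ := (abs_nonneg _).trans (hB₃ 0)
  set q : ℝ := (2 - t₁) / t₁ with hq
  have hq4 : 4 ≤ q := midRatio_ge_four ht₀ ht25
  have hI : 0 ≤ (max e |u|)⁻¹ ^ 3 := by positivity
  rcases le_or_gt e (2 * q * lo) with hsmall | hbig
  · have hK : e ≤ 2 * q * Λ := hsmall.trans (by nlinarith)
    refine (abs_ppTrueKernelDuu_le_inv_max_cube_of_le_mul hβ hΛ hB₁ hB₂ hB₃ (K := 2 * q) (by linarith) he hK u).trans ?_
    apply mul_le_mul_of_nonneg_right _ hI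
    nlinarith [sq_nonneg q]
  · have hsupp := comparable_abs_lower ht₀ ht25 hlo hbig.le hc
    have hc0 : 0 < 1 / (2 * q) := by positivity
    have hc1 : 1 / (2 * q) ≤ 1 := by rw [div_le_one (by positivity)]; linarith
    refine (abs_ppTrueKernelDuu_le_inv_max_cube hβ hΛ hB₁ hB₂ hB₃ hc0 hc1 he hsupp).trans ?_
    apply mul_le_mul_of_nonneg_right _ hI
    have e1 : (32 * B₂ + 48 * B₁ + 66) / (1 / (2 * q)) ^ 2 = (128 * B₂ + 192 * B₁ + 264) * q ^ 2 := by field_simp; ring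
    have e2 : (48 * B₁ + 36) / (1 / (2 * q)) = (96 * B₁ + 72) * q := by field_simp; ring
    rw [e1, e2]; nlinarith [sq_nonneg q]

/-! ## §2 The rows -/

include hβ hΛ hB₁ hκb hlo in
/-- **ROW `hK0`**: `0 < e` ⟹ `|M(e,u)| ≤ (1+2κ₀)(12B₁+9)·(max e |u|)⁻¹` for every `u`. [cite: BenfattoGiulianiMastropietro2006, §2.4 (2.36)] -/
theorem abs_ppMidKernelS_le_inv_max' {e : ℝ} (he : 0 < e) (u : ℝ) :
    |ppMidKernelS β Λ κ lo e u| ≤ (1 + 2 * κ₀) * (12 * B₁ + 9) * (max e |u|)⁻¹ := by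
  have h := (abs_ppFarKernelS_le_inv_max hβ hΛ hB₁ hlo hκb he.ne' u (κ := κ)).2
  rwa [abs_of_pos he] at h

include hβ hΛ hB₁ hB₂ hκ hκb hκ'b ht₀ ht25 hκs hκ's hκ1 hκ'1 hlo hloΛ in
/-- **ROW `hK1`**: `0 < e` ⟹ `|∂ᵤM(e,u)| ≤ ((1+2κ₀)·C_P1 + 2κ₁(12B₁+9))·(max e |u|)⁻¹²` for every `u ∈ ℝ` (off the comparable zone `∂ᵤM = 0`).
[cite: BenfattoGiulianiMastropietro2006, §2.4 (2.36)] -/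
theorem abs_deriv_ppMidKernelS_le {e : ℝ} (he : 0 < e) (u : ℝ) :
    |deriv (fun v : ℝ => ppMidKernelS β Λ κ lo e v) u| ≤
      ((1 + 2 * κ₀) * (128 * B₂ + 216 * B₁ + 294 + (48 * B₁ + 28) * ((2 - t₁) / t₁)) + 2 * κ₁ * (12 * B₁ + 9)) * (max e |u|)⁻¹ ^ 2 := by
  have hB0 := salmhoferB₁_nonneg hB₁
  have hB20 : 0 ≤ B₂ := (abs_nonneg _).trans (hB₂ 0)
  have hκ₀ : 0 ≤ κ₀ := (abs_nonneg _).trans (hκb 0 (left_mem_Icc.2 zero_le_one))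
  have hκ₁ : 0 ≤ κ₁ := (abs_nonneg _).trans (hκ'b 0 (left_mem_Icc.2 zero_le_one))
  set q : ℝ := (2 - t₁) / t₁ with hq
  have hq4 : 4 ≤ q := midRatio_ge_four ht₀ ht25
  set M : ℝ := max e |u| with hM
  have hM0 : 0 < M := he.trans_le (le_max_left _ _)
  have hRHS : 0 ≤ ((1 + 2 * κ₀) * (128 * B₂ + 216 * B₁ + 294 + (48 * B₁ + 28) * q) + 2 * κ₁ * (12 * B₁ + 9)) * M⁻¹ ^ 2 := by positivity
  rw [(hasDerivAt_ppMidKernelS_u hβ hΛ hB₁ hκ hlo e u).deriv]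
  by_cases hz : ppSmoothScale lo u < (2 - t₁) / t₁ * ppSmoothScale lo e ∧ ppSmoothScale lo e < (2 - t₁) / t₁ * ppSmoothScale lo u
  · -- on the zone
    have hr := ppSmoothRatio_mem_Ioo hlo e u
    have hm : |1 - κ (ppSmoothRatio lo e u) - κ (1 - ppSmoothRatio lo e u)| ≤ 1 + 2 * κ₀ := by
      have hk1 := hκb _ ⟨hr.1.le, hr.2.le⟩
      have hk2 := hκb (1 - ppSmoothRatio lo e u) ⟨by linarith [hr.2], by linarith [hr.1]⟩
      have h3 := abs_sub (1 : ℝ) (κ (ppSmoothRatio lo e u)); rw [abs_one] at h3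
      calc _ ≤ |1 - κ (ppSmoothRatio lo e u)| + |κ (1 - ppSmoothRatio lo e u)| := abs_sub _ _
        _ ≤ 1 + 2 * κ₀ := by linarith
    have hdk : |κ' (1 - ppSmoothRatio lo e u) - κ' (ppSmoothRatio lo e u)| ≤ 2 * κ₁ := by
      have hk1 := hκ'b _ ⟨hr.1.le, hr.2.le⟩
      have hk2 := hκ'b (1 - ppSmoothRatio lo e u) ⟨by linarith [hr.2], by linarith [hr.1]⟩
      calc _ ≤ |κ' (1 - ppSmoothRatio lo e u)| + |κ' (ppSmoothRatio lo e u)| := abs_sub _ _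
        _ ≤ 2 * κ₁ := by linarith
    have hP := abs_ppTrueKernel_le_inv_max hβ hΛ hB₁ he u
    have hP' := abs_ppTrueKernelDu_le_of_comparable hβ hΛ hB₁ hB₂ ht₀ ht25 hlo hloΛ he hz.2
    have hr' : |-(ppSmoothScale lo e * (u / ppSmoothScale lo u)) / (ppSmoothScale lo e + ppSmoothScale lo u) ^ 2| ≤ M⁻¹ := by
      refine (abs_ppSmoothRatioD1_le hlo e u).trans ?_
      have := inv_ppSmoothScale_add_le_inv_max hlo he.ne' u
      rwa [abs_of_pos he] at this
    have hA : |ppTrueKernelDu β Λ e u * (1 - κ (ppSmoothRatio lo e u) - κ (1 - ppSmoothRatio lo e u))| ≤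
        (128 * B₂ + 216 * B₁ + 294 + (48 * B₁ + 28) * q) * M⁻¹ ^ 2 * (1 + 2 * κ₀) := by
      rw [abs_mul]; exact mul_le_mul hP' hm (abs_nonneg _) (by positivity)
    have hB : |ppTrueKernel β Λ e u * ((κ' (1 - ppSmoothRatio lo e u) - κ' (ppSmoothRatio lo e u)) *
        (-(ppSmoothScale lo e * (u / ppSmoothScale lo u)) / (ppSmoothScale lo e + ppSmoothScale lo u) ^ 2))| ≤ (12 * B₁ + 9) * M⁻¹ * (2 * κ₁ * M⁻¹) := by
      rw [abs_mul, abs_mul]; exact mul_le_mul hP (mul_le_mul hdk hr' (abs_nonneg _) (by positivity)) (by positivity) (by positivity)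
    refine ((abs_add_le _ _).trans (add_le_add hA hB)).trans (le_of_eq ?_)
    ring
  · obtain ⟨h0, h1, h2⟩ := midFactor_eq_zero_of_not_comparable ht₀ ht25 hκs hκ's hκ1 hκ'1 hlo hz
    rw [h0, h1, h2]; simp only [mul_zero, sub_self, zero_mul, add_zero, abs_zero]; exact hRHS

include hβ hΛ hB₁ hB₂ hB₃ hκ hκ' hκb hκ'b hκ''b ht₀ ht25 hκs hκ's hκ''s hκ1 hκ'1 hκ''1 hlo hloΛ in
/-- **ROW `hK2`**: `0 < e` ⟹ `|∂ᵤ²M(e,u)| ≤ ((1+2κ₀)C_P2 + 4κ₁C_P1 + (12B₁+9)(2κ₂ + 2κ₁(q′+2)))·(max e |u|)⁻¹³` for every `u ∈ ℝ`.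
[cite: BenfattoGiulianiMastropietro2006, §2.4 (2.36)] -/
theorem abs_iteratedDeriv_two_ppMidKernelS_le {e : ℝ} (he : 0 < e) (u : ℝ) :
    |iteratedDeriv 2 (fun v : ℝ => ppMidKernelS β Λ κ lo e v) u| ≤
      ((1 + 2 * κ₀) * (512 * B₃ + 1664 * B₂ + 5280 * B₁ + 3424 + (256 * B₂ + 384 * B₁ + 504) * ((2 - t₁) / t₁) ^ 2 + (192 * B₁ + 112) * ((2 - t₁) / t₁)) +
          4 * κ₁ * (128 * B₂ + 216 * B₁ + 294 + (48 * B₁ + 28) * ((2 - t₁) / t₁)) +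
          (12 * B₁ + 9) * (2 * κ₂ + 2 * κ₁ * ((2 - t₁) / t₁ + 2))) * (max e |u|)⁻¹ ^ 3 := by
  have hB0 := salmhoferB₁_nonneg hB₁
  have hB20 : 0 ≤ B₂ := (abs_nonneg _).trans (hB₂ 0)
  have hB30 : 0 ≤ B₃ := (abs_nonneg _).trans (hB₃ 0)
  have hκ₀ : 0 ≤ κ₀ := (abs_nonneg _).trans (hκb 0 (left_mem_Icc.2 zero_le_one))
  have hκ₁ : 0 ≤ κ₁ := (abs_nonneg _).trans (hκ'b 0 (left_mem_Icc.2 zero_le_one))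
  have hκ₂ : 0 ≤ κ₂ := (abs_nonneg _).trans (hκ''b 0 (left_mem_Icc.2 zero_le_one))
  set q : ℝ := (2 - t₁) / t₁ with hq
  have hq4 : 4 ≤ q := midRatio_ge_four ht₀ ht25
  set M : ℝ := max e |u| with hM
  have hM0 : 0 < M := he.trans_le (le_max_left _ _)
  set CP1 : ℝ := 128 * B₂ + 216 * B₁ + 294 + (48 * B₁ + 28) * q with hCP1
  set CP2 : ℝ := 512 * B₃ + 1664 * B₂ + 5280 * B₁ + 3424 + (256 * B₂ + 384 * B₁ + 504) * q ^ 2 + (192 * B₁ + 112) * q with hCP2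
  have hCP1 : 0 ≤ CP1 := by positivity
  have hCP2 : 0 ≤ CP2 := by positivity
  have hRHS : 0 ≤ ((1 + 2 * κ₀) * CP2 + 4 * κ₁ * CP1 + (12 * B₁ + 9) * (2 * κ₂ + 2 * κ₁ * (q + 2))) * M⁻¹ ^ 3 := by positivity
  rw [iteratedDeriv_two_ppMidKernelS_u hβ hΛ hB₁ hB₂ hκ hκ' hlo e u]
  by_cases hz : ppSmoothScale lo u < (2 - t₁) / t₁ * ppSmoothScale lo e ∧ ppSmoothScale lo e < (2 - t₁) / t₁ * ppSmoothScale lo u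
  · have hr := ppSmoothRatio_mem_Ioo hlo e u
    have hIcc1 : ppSmoothRatio lo e u ∈ Icc (0 : ℝ) 1 := ⟨hr.1.le, hr.2.le⟩
    have hIcc2 : 1 - ppSmoothRatio lo e u ∈ Icc (0 : ℝ) 1 := ⟨by linarith [hr.2], by linarith [hr.1]⟩
    have hm : |1 - κ (ppSmoothRatio lo e u) - κ (1 - ppSmoothRatio lo e u)| ≤ 1 + 2 * κ₀ := by
      have hk1 := hκb _ hIcc1; have hk2 := hκb _ hIcc2
      have h3 := abs_sub (1 : ℝ) (κ (ppSmoothRatio lo e u)); rw [abs_one] at h3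
      calc _ ≤ |1 - κ (ppSmoothRatio lo e u)| + |κ (1 - ppSmoothRatio lo e u)| := abs_sub _ _
        _ ≤ 1 + 2 * κ₀ := by linarith
    have hdk : |κ' (1 - ppSmoothRatio lo e u) - κ' (ppSmoothRatio lo e u)| ≤ 2 * κ₁ := by
      have hk1 := hκ'b _ hIcc1; have hk2 := hκ'b _ hIcc2
      calc _ ≤ |κ' (1 - ppSmoothRatio lo e u)| + |κ' (ppSmoothRatio lo e u)| := abs_sub _ _
        _ ≤ 2 * κ₁ := by linarith
    have hddk : |-(κ'' (1 - ppSmoothRatio lo e u) + κ'' (ppSmoothRatio lo e u))| ≤ 2 * κ₂ := by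
      have hk1 := hκ''b _ hIcc1; have hk2 := hκ''b _ hIcc2
      rw [abs_neg]
      calc _ ≤ |κ'' (1 - ppSmoothRatio lo e u)| + |κ'' (ppSmoothRatio lo e u)| := abs_add_le _ _
        _ ≤ 2 * κ₂ := by linarith
    have hP := abs_ppTrueKernel_le_inv_max hβ hΛ hB₁ he u
    have hP' := abs_ppTrueKernelDu_le_of_comparable hβ hΛ hB₁ hB₂ ht₀ ht25 hlo hloΛ he hz.2
    have hP'' := abs_ppTrueKernelDuu_le_of_comparable hβ hΛ hB₁ hB₂ hB₃ ht₀ ht25 hlo hloΛ he hz.2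
    have hSM : 1 / (ppSmoothScale lo e + ppSmoothScale lo u) ≤ M⁻¹ := by
      have := inv_ppSmoothScale_add_le_inv_max hlo he.ne' u
      rwa [abs_of_pos he] at this
    have hr' : |-(ppSmoothScale lo e * (u / ppSmoothScale lo u)) / (ppSmoothScale lo e + ppSmoothScale lo u) ^ 2| ≤ M⁻¹ :=
      (abs_ppSmoothRatioD1_le hlo e u).trans hSM
    have hr'' : |-(ppSmoothScale lo e * ((lo ^ 2 / ppSmoothScale lo u ^ 3) * (ppSmoothScale lo e + ppSmoothScale lo u) - 2 * (u / ppSmoothScale lo u) ^ 2)) /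
        (ppSmoothScale lo e + ppSmoothScale lo u) ^ 3| ≤ (q + 2) * M⁻¹ ^ 2 := by
      refine (abs_ppSmoothRatioD2_le_of_scale hlo hz.2.le).trans ?_
      have hS0 : 0 ≤ 1 / (ppSmoothScale lo e + ppSmoothScale lo u) := by
        have := ppSmoothScale_pos hlo e; have := ppSmoothScale_pos hlo u; positivity
      calc (q + 2) / (ppSmoothScale lo e + ppSmoothScale lo u) ^ 2 = (q + 2) * (1 / (ppSmoothScale lo e + ppSmoothScale lo u)) ^ 2 := by
            rw [one_div_pow]; ring
        _ ≤ (q + 2) * M⁻¹ ^ 2 := mul_le_mul_of_nonneg_left (pow_le_pow_left₀ hS0 hSM 2) (by positivity)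
    -- the three terms
    have hA : |ppTrueKernelDuu β Λ e u * (1 - κ (ppSmoothRatio lo e u) - κ (1 - ppSmoothRatio lo e u))| ≤ CP2 * M⁻¹ ^ 3 * (1 + 2 * κ₀) := by
      rw [abs_mul]; exact mul_le_mul hP'' hm (abs_nonneg _) (by positivity)
    have hB : |2 * ppTrueKernelDu β Λ e u * ((κ' (1 - ppSmoothRatio lo e u) - κ' (ppSmoothRatio lo e u)) *
        (-(ppSmoothScale lo e * (u / ppSmoothScale lo u)) / (ppSmoothScale lo e + ppSmoothScale lo u) ^ 2))| ≤ 2 * (CP1 * M⁻¹ ^ 2) * (2 * κ₁ * M⁻¹) := by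
      rw [abs_mul, abs_mul, abs_mul, abs_of_pos (by norm_num : (0 : ℝ) < 2)]
      exact mul_le_mul (mul_le_mul_of_nonneg_left hP' (by norm_num)) (mul_le_mul hdk hr' (abs_nonneg _) (by positivity)) (by positivity) (by positivity)
    have hC : |ppTrueKernel β Λ e u *
        (-(κ'' (1 - ppSmoothRatio lo e u) + κ'' (ppSmoothRatio lo e u)) *
            (-(ppSmoothScale lo e * (u / ppSmoothScale lo u)) / (ppSmoothScale lo e + ppSmoothScale lo u) ^ 2) ^ 2 +
          (κ' (1 - ppSmoothRatio lo e u) - κ' (ppSmoothRatio lo e u)) *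
            (-(ppSmoothScale lo e * ((lo ^ 2 / ppSmoothScale lo u ^ 3) * (ppSmoothScale lo e + ppSmoothScale lo u) - 2 * (u / ppSmoothScale lo u) ^ 2)) /
              (ppSmoothScale lo e + ppSmoothScale lo u) ^ 3))| ≤ (12 * B₁ + 9) * M⁻¹ * (2 * κ₂ * M⁻¹ ^ 2 + 2 * κ₁ * ((q + 2) * M⁻¹ ^ 2)) := by
      rw [abs_mul]
      refine mul_le_mul hP ((abs_add_le _ _).trans (add_le_add ?_ ?_)) (abs_nonneg _) (by positivity)
      · rw [abs_mul, abs_pow]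
        exact mul_le_mul hddk (pow_le_pow_left₀ (abs_nonneg _) hr' 2) (by positivity) (by positivity)
      · rw [abs_mul]; exact mul_le_mul hdk hr'' (abs_nonneg _) (by positivity)
    refine ((abs_add_le _ _).trans (add_le_add ((abs_add_le _ _).trans (add_le_add hA hB)) hC)).trans (le_of_eq ?_)
    ring
  · obtain ⟨h0, h1, h2⟩ := midFactor_eq_zero_of_not_comparable ht₀ ht25 hκs hκ's hκ1 hκ'1 hlo hz
    obtain ⟨h3, h4⟩ := midFactorD2_eq_zero_of_not_comparable ht₀ ht25 hκ''s hκ''1 hlo hz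
    rw [h0, h1, h2, h3, h4]; simp only [mul_zero, sub_self, zero_mul, add_zero, neg_zero, abs_zero]; exact hRHS

include hβ hΛ hB₁ hB₂ hκ hκ' ht₀ ht25 hκs hκ's hκ''s hκ1 hκ'1 hκ''1 hlo in
/-- **ROW `hcomp` (partner at least `2q′×` coarser)**: `lo ≤ e`, `2q′e ≤ |u|` ⟹ `∂ᵤM(e,u) = 0` and `∂ᵤ²M(e,u) = 0`.
[cite: FeldmanSalmhoferTrubowitz1998, §3] -/
theorem deriv_ppMidKernelS_eq_zero_of_ge {e u : ℝ} (he : lo ≤ e) (hu : 2 * ((2 - t₁) / t₁) * e ≤ |u|) :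
    deriv (fun v : ℝ => ppMidKernelS β Λ κ lo e v) u = 0 ∧ iteratedDeriv 2 (fun v : ℝ => ppMidKernelS β Λ κ lo e v) u = 0 := by
  have hz := not_comparable_of_ge ht₀ ht25 hlo he hu
  obtain ⟨h0, h1, h2⟩ := midFactor_eq_zero_of_not_comparable ht₀ ht25 hκs hκ's hκ1 hκ'1 hlo hz
  obtain ⟨h3, h4⟩ := midFactorD2_eq_zero_of_not_comparable ht₀ ht25 hκ''s hκ''1 hlo hz
  rw [(hasDerivAt_ppMidKernelS_u hβ hΛ hB₁ hκ hlo e u).deriv, iteratedDeriv_two_ppMidKernelS_u hβ hΛ hB₁ hB₂ hκ hκ' hlo e u, h0, h1, h2, h3, h4]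
  constructor <;> ring

include hβ hΛ hB₁ hB₂ hκ hκ' ht₀ ht25 hκs hκ's hκ''s hκ1 hκ'1 hκ''1 hlo in
/-- **ROW `hcomp′` (partner at least `2q′×` finer, loop level `e ≥ 2q′lo`)**: `2q′|u| ≤ e` ⟹ `∂ᵤM(e,u) = 0` and `∂ᵤ²M(e,u) = 0`.
[cite: FeldmanSalmhoferTrubowitz1998, §3] -/
theorem deriv_ppMidKernelS_eq_zero_of_le {e u : ℝ} (he : 2 * ((2 - t₁) / t₁) * lo ≤ e) (hu : 2 * ((2 - t₁) / t₁) * |u| ≤ e) :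
    deriv (fun v : ℝ => ppMidKernelS β Λ κ lo e v) u = 0 ∧ iteratedDeriv 2 (fun v : ℝ => ppMidKernelS β Λ κ lo e v) u = 0 := by
  have hz := not_comparable_of_le ht₀ ht25 hlo he hu
  obtain ⟨h0, h1, h2⟩ := midFactor_eq_zero_of_not_comparable ht₀ ht25 hκs hκ's hκ1 hκ'1 hlo hz
  obtain ⟨h3, h4⟩ := midFactorD2_eq_zero_of_not_comparable ht₀ ht25 hκ''s hκ''1 hlo hz
  rw [(hasDerivAt_ppMidKernelS_u hβ hΛ hB₁ hκ hlo e u).deriv, iteratedDeriv_two_ppMidKernelS_u hβ hΛ hB₁ hB₂ hκ hκ' hlo e u, h0, h1, h2, h3, h4]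
  constructor <;> ring

include ht₀ ht25 hκs hκ's hκ1 hκ'1 hlo in
/-- **Off the comparable zone `M` itself vanishes too** (`lo ≤ e`, `2q′e ≤ |u|`). [cite: FeldmanSalmhoferTrubowitz1998, §3] -/
theorem ppMidKernelS_eq_zero_of_ge {e u : ℝ} (he : lo ≤ e) (hu : 2 * ((2 - t₁) / t₁) * e ≤ |u|) : ppMidKernelS β Λ κ lo e u = 0 := by
  have hz := not_comparable_of_ge ht₀ ht25 hlo he hu
  obtain ⟨h0, -, -⟩ := midFactor_eq_zero_of_not_comparable ht₀ ht25 hκs hκ's hκ1 hκ'1 hlo hz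
  unfold ppMidKernelS; rw [h0, mul_zero]

include hβ hΛ hB₁ hκ hlo in
/-- **Joint continuity of `∂ᵤM` on all of ℝ²** (the primed laws' `hKc` shape). [cite: BenfattoGiulianiMastropietro2006, §2.4 (2.36)] -/
theorem continuous_deriv_ppMidKernelS₂ (hκ'c : Continuous κ') : Continuous fun p : ℝ × ℝ => deriv (fun v : ℝ => ppMidKernelS β Λ κ lo p.1 v) p.2 := by
  have hd : ∀ p : ℝ × ℝ, deriv (fun v : ℝ => ppMidKernelS β Λ κ lo p.1 v) p.2 =
      ppTrueKernelDu β Λ p.1 p.2 * (1 - κ (ppSmoothRatio lo p.1 p.2) - κ (1 - ppSmoothRatio lo p.1 p.2)) +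
        ppTrueKernel β Λ p.1 p.2 * ((κ' (1 - ppSmoothRatio lo p.1 p.2) - κ' (ppSmoothRatio lo p.1 p.2)) *
          (-(ppSmoothScale lo p.1 * (p.2 / ppSmoothScale lo p.2)) / (ppSmoothScale lo p.1 + ppSmoothScale lo p.2) ^ 2)) :=
    fun p => (hasDerivAt_ppMidKernelS_u hβ hΛ hB₁ hκ hlo p.1 p.2).deriv
  simp_rw [hd]
  have hκc : Continuous κ := continuous_iff_continuousAt.2 fun t => (hκ t).continuousAt
  have hr : Continuous fun p : ℝ × ℝ => ppSmoothRatio lo p.1 p.2 := continuous_ppSmoothRatio₂ hlo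
  have hSe : Continuous fun p : ℝ × ℝ => ppSmoothScale lo p.1 := (contDiff_ppSmoothScale hlo (n := 0)).continuous.comp continuous_fst
  have hSu : Continuous fun p : ℝ × ℝ => ppSmoothScale lo p.2 := (contDiff_ppSmoothScale hlo (n := 0)).continuous.comp continuous_snd
  have hP : Continuous fun p : ℝ × ℝ => ppTrueKernel β Λ p.1 p.2 := continuous_ppTrueKernel_comp hβ Λ continuous_fst continuous_snd
  have hP' : Continuous fun p : ℝ × ℝ => ppTrueKernelDu β Λ p.1 p.2 := continuous_ppTrueKernelDu_comp hβ hΛ hB₁ continuous_fst continuous_snd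
  have hr' : Continuous fun p : ℝ × ℝ => -(ppSmoothScale lo p.1 * (p.2 / ppSmoothScale lo p.2)) / (ppSmoothScale lo p.1 + ppSmoothScale lo p.2) ^ 2 := by
    refine Continuous.div (by fun_prop (disch := exact fun p => (ppSmoothScale_pos hlo _).ne')) (by fun_prop) fun p => ?_
    have := ppSmoothScale_pos hlo p.1; have := ppSmoothScale_pos hlo p.2; positivity
  exact (hP'.mul ((continuous_const.sub (hκc.comp hr)).sub (hκc.comp (continuous_const.sub hr)))).add
    (hP.mul (((hκ'c.comp (continuous_const.sub hr)).sub (hκ'c.comp hr)).mul hr'))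


end Rows

end Summit.HubbardSuperconductivity.HubbardSuperconductivity.Theorems.C4a

end
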